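import Summits.CriticalPhenomena.PercolationContinuityZ3.Theorems.Transplant.KNCellsProcessO
import Summits.CriticalPhenomena.PercolationContinuityZ3.Theorems.Transplant.KNCellsProcess
import Summits.CriticalPhenomena.PercolationContinuityZ3.Theorems.Transplant.KNCellsSchemeO
import Summits.CriticalPhenomena.PercolationContinuityZ3.Theorems.Transplant.KNCellsRun
import Literature.Probability.Percolation.OrientedHistorySiteRenormalizationRun
import HarnessLib

/-!
# N2 (frames-only node `SamePDropOfSkeletonFrm₁`, OPEN) — ORIENTED MACRO LAYER (WAVE 0 (c1), (R-18) `q ≡ true`): the oriented twin of N1's `KNCellsRun`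

builds on p205010 (kernel theorem, internal audit signed; external expert review pending) — nothing in this file uses p205010; NOTHING is claimed about the
open node `SamePDropOfSkeletonFrm₁` (`SamePDropOfSkeletonNeg₁` is CLOSED in the tree and untouched by this file).
Status sentence (coordinator 2026-08-20T04:30Z): "θ(p_c) = 0 on ℤ^d, all d ≥ 2 — kernel-verified (Lean 4/Mathlib, standard axioms); internal adversarial
audit SIGNED 2026-08-20 04:29Z; external expert review pending."
Lane `prim-bschramm-*`, seat `prim-bschramm-stmt` (gen 19); helper file (`--supports stmt-CriticalPhenomena-4575 --as helper`); N2-SCOPE §20, (R-18)/(R-19).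
PORT RULES (HOME/prim-bschramm-stmt-g19/lean/port_orient.py): the history-site API is replaced by its ORIENTED twin at the fixed quadrant `qNE := fun _ => true`
(`HState.choice ↦ HState.ochoice qNE`, `mstOf ↦ omstOf qNE`, `mst/stN ↦ omst/ostN qNE`, `occFinal ↦ ooccFinal qNE`, `Lawful ↦ OLawful qNE`, onward directions
`onward ↦ onwardO` = the POSITIVE ones, (N2-e)); every declaration whose text changes thereby — directly or through a changed declaration — is re-declared with the
suffix `O` (same namespace); unchanged declarations of the N1 file are NOT repeated (the N1 module is imported). Docstrings/citations are N1's.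
N1 HEADER (kept for the reader):
* §1 unfolding: `hst`, `aOf`/`oOf`/`dOf`/`newR`, `next_cases`, `of_next_some`, `F`/`ξ` along `cons`, `F_mono`, `V_mono`, `step_none`, `step_some`,
  and the ANCHOR STEP `astOf_step_some` (arrival anchor of the target := source's departure anchor; departure anchor := `dOf`);
* `anchors_step_of_ne`, **`anchors_eq_of_det`** (anchors of determined macro-vertices are frozen: a determined vertex is never a target again).
The run invariant itself (`RunGeom`, `RunInv`, `runInv`) is `KNCellsRunInv`.
[cite: KozmaNitzan2024, §4 pp. 26–27 ((29), E_{i+1}) — the ℤ^d model] [cite: GrimmettPercolation1999, §7.2]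
-/
noncomputable section

open MeasureTheory ProbabilityTheory
open scoped ENNReal Classical

namespace Summit.CriticalPhenomena.PercolationContinuityZ3.Theorems

namespace Transplant

namespace KNCells

open Literature.Probability.Percolation Literature.Probability.LatticeModels SimpleGraph GadgetSystem ProbeHistory HSiteScheme
open Literature.Probability.Percolation.KozmaNitzan (opens opens_nil opens_cons_none opens_cons_some)

variable {V : Type*} [DecidableEq V]

/-! ## §1 Unfolding the scheme along the run -/

namespace KSchA

variable {A : Type*} {G : SimpleGraph V} [G.LocallyFinite] (S : KSchA V A)

/-- The explorer of the scheme is `nextProbeO`. [folklore] -/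
theorem scheme_nextO : (S.schemeO G).E.next = S.nextProbeO G := rfl

/-- The success criterion of the scheme is `succO`. [folklore] -/
theorem scheme_succO : (S.schemeO G).succ = S.succO G := rfl

/-- The initial edges of the scheme are `U₀`. [folklore] -/
theorem scheme_U₀O : (S.schemeO G).U₀ = S.U₀ G := rfl

variable (G) in
/-- The history of the run after `n` steps. [folklore] -/
abbrev hstO (ω : BondConfig V) (n : ℕ) : ProbeHistory V := (S.schemeO G).E.hist n ω

variable (G) in
/-- The source anchor of the examination along `e` after `h`: the replayed departure anchor of `e.1`. [folklore] -/
abbrev aOfO (h : ProbeHistory V) (e : Site 2 × MDir) : A := (S.astOfO G h).dep e.1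

variable (G) in
/-- The observation of the examination along `e` after `h` on `ω` (the open edges of the envelope). [folklore] -/
abbrev oOfO (ω : BondConfig V) (h : ProbeHistory V) (e : Site 2 × MDir) : Finset (Sym2 V) := obs ω (S.envO G h e (S.aOfO G h e))

variable (G) in
/-- The departure anchor chosen for `tgt e` by the examination along `e` after `h` on `ω`. [folklore] -/
abbrev dOfO (ω : BondConfig V) (h : ProbeHistory V) (e : Site 2 × MDir) : A := S.depA G h e (S.aOfO G h e) (S.oOfO G ω h e)

variable (G) in
/-- The new region revealed by the examination along `e` after `h` on `ω`. [folklore] -/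
abbrev newRO (ω : BondConfig V) (h : ProbeHistory V) (e : Site 2 × MDir) : Finset V :=
  S.newRegionO G h e (S.aOfO G h e) (S.dOfO G ω h e) (S.oOfO G ω h e)

/-- The macro-state of the run is the macro part of the anchored replay of its history. [folklore] -/
theorem stN_eqO (n : ℕ) (ω : BondConfig V) : (S.schemeO G).ostN qNE n ω = (S.astOfO G (S.hstO G ω n)).st := S.mst_eq_astOfO _

/-- **The three cases of a step**: no probe, or a valid history with a chosen edge, examined by the probe at the source's departure anchor.
[folklore] -/
theorem next_casesO (ω : BondConfig V) (n : ℕ) :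
    (S.schemeO G).E.next (S.hstO G ω n) = none ∨
      ∃ e, ((S.schemeO G).ostN qNE n ω).ochoice qNE = some e ∧ S.ValidO G (S.hstO G ω n) e ∧
        (S.schemeO G).E.next (S.hstO G ω n) = some (S.probeO G (S.hstO G ω n) e (S.aOfO G (S.hstO G ω n) e)) := by
  rw [scheme_nextO]
  cases hP : S.nextProbeO G (S.hstO G ω n) with
  | none => exact Or.inl rfl
  | some P =>
    obtain ⟨e, hc, hV, rfl⟩ := S.nextProbe_eq_someO hP
    exact Or.inr ⟨e, by rw [stN_eqO]; exact hc, hV, rfl⟩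

/-- If a probe is made then it is the examination of the chosen edge after a valid history. [folklore] -/
theorem of_next_someO {ω : BondConfig V} {n : ℕ} {P : AProbe V} (hP : (S.schemeO G).E.next (S.hstO G ω n) = some P) :
    ∃ e, ((S.schemeO G).ostN qNE n ω).ochoice qNE = some e ∧ S.ValidO G (S.hstO G ω n) e ∧ P = S.probeO G (S.hstO G ω n) e (S.aOfO G (S.hstO G ω n) e) := by
  rw [scheme_nextO] at hP
  obtain ⟨e, hc, hV, hPe⟩ := S.nextProbe_eq_someO hP
  exact ⟨e, by rw [stN_eqO]; exact hc, hV, hPe⟩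

/-- `F` only grows along the run. [folklore] -/
theorem F_monoO (ω : BondConfig V) : Monotone fun n => S.F G (S.hstO G ω n) := by
  refine monotone_nat_of_le_succ fun n => ?_
  show S.F G (S.hstO G ω n) ⊆ S.F G (S.hstO G ω (n + 1))
  exact S.F_subset_cons _ _

/-- The explored region only grows along the run. [folklore] -/
theorem V_monoO (ω : BondConfig V) : Monotone fun n => S.Vx G (S.hstO G ω n) := fun _ _ hmn =>
  vspan_mono (S.F_monoO ω hmn)

/-- No probe: `F`, `ξ`, the macro-state and the anchors are unchanged. [folklore] -/
theorem step_noneO {ω : BondConfig V} {n : ℕ} (hD : (S.schemeO G).E.next (S.hstO G ω n) = none) :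
    S.F G (S.hstO G ω (n + 1)) = S.F G (S.hstO G ω n) ∧ S.ξ G (S.hstO G ω (n + 1)) = S.ξ G (S.hstO G ω n) ∧
      (S.schemeO G).ostN qNE (n + 1) ω = (S.schemeO G).ostN qNE n ω ∧ S.astOfO G (S.hstO G ω (n + 1)) = S.astOfO G (S.hstO G ω n) := by
  have h1 : S.hstO G ω (n + 1) = none :: S.hstO G ω n := by
    show (S.schemeO G).E.hist (n + 1) ω = _
    rw [AExplorer.hist_succ, (S.schemeO G).E.step_of_none hD]
  rw [h1, F_cons_none, ξ_cons_none, astOf_cons_noneO]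
  exact ⟨rfl, rfl, (S.schemeO G).ostN_succ_of_next_none qNE hD, rfl⟩

/-- A probe along `e`: the history gains the probe's record. [folklore] -/
theorem hst_succ_of_someO {ω : BondConfig V} {n : ℕ} {e : Site 2 × MDir}
    (hD : (S.schemeO G).E.next (S.hstO G ω n) = some (S.probeO G (S.hstO G ω n) e (S.aOfO G (S.hstO G ω n) e))) :
    S.hstO G ω (n + 1) = some ((S.probeO G (S.hstO G ω n) e (S.aOfO G (S.hstO G ω n) e)).record ω) :: S.hstO G ω n := by
  show (S.schemeO G).E.hist (n + 1) ω = _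
  rw [AExplorer.hist_succ, (S.schemeO G).E.step_of_some hD]

/-- The record of the examination: revealed edges `revealOfO … (oOfO)` and observation `obs ω` of them. [folklore] -/
theorem probe_recordO (ω : BondConfig V) (h : ProbeHistory V) (e : Site 2 × MDir) :
    (S.probeO G h e (S.aOfO G h e)).record ω =
      (S.revealOfO G h e (S.aOfO G h e) (S.oOfO G ω h e), obs ω (S.revealOfO G h e (S.aOfO G h e) (S.oOfO G ω h e))) := rfl

/-- The departure anchor read off the probe's observation is the one read off the envelope's observation. [folklore] -/
theorem depA_readO (ω : BondConfig V) (h : ProbeHistory V) (e : Site 2 × MDir) :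
    S.depA G h e (S.aOfO G h e) ((S.probeO G h e (S.aOfO G h e)).read ω) = S.dOfO G ω h e := by
  refine S.depA_congr h e _ fun x hx => ?_
  have hxr : x ∈ S.revealOfO G h e (S.aOfO G h e) (S.oOfO G ω h e) := S.baseF_sdiff_subset_revealOfO h e _ _ hx
  have hxe : x ∈ S.envO G h e (S.aOfO G h e) := S.revealOf_subset_envO h e _ _ hxr
  simp only [AProbe.read, probeO, mem_obs_iff, hxe, hxr, true_and]

/-- A probe along `e`: `F` gains the revealed edges, `ξ` the observed ones, the macro-state is updated by the success of the examination,
the target's arrival anchor becomes the source's departure anchor and its departure anchor the one read off the observation; all other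
anchors are unchanged. [cite: KozmaNitzan2024, §4 p. 27 (E_{i+1}, G_{i+1}, X_{i+1})] -/
theorem step_someO {ω : BondConfig V} {n : ℕ} {e : Site 2 × MDir} (hc : ((S.schemeO G).ostN qNE n ω).ochoice qNE = some e)
    (hD : (S.schemeO G).E.next (S.hstO G ω n) = some (S.probeO G (S.hstO G ω n) e (S.aOfO G (S.hstO G ω n) e))) :
    S.F G (S.hstO G ω (n + 1)) = S.F G (S.hstO G ω n) ∪ S.revealOfO G (S.hstO G ω n) e (S.aOfO G (S.hstO G ω n) e) (S.oOfO G ω (S.hstO G ω n) e) ∧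
      S.ξ G (S.hstO G ω (n + 1)) = S.ξ G (S.hstO G ω n) ∪
        obs ω (S.revealOfO G (S.hstO G ω n) e (S.aOfO G (S.hstO G ω n) e) (S.oOfO G ω (S.hstO G ω n) e)) ∧
      (S.schemeO G).ostN qNE (n + 1) ω = ((S.schemeO G).ostN qNE n ω).update e
        (S.succO G (S.hstO G ω n) e ((S.probeO G (S.hstO G ω n) e (S.aOfO G (S.hstO G ω n) e)).read ω)) ∧
      (S.astOfO G (S.hstO G ω (n + 1))).arr = Function.update (S.astOfO G (S.hstO G ω n)).arr (tgt e) (S.aOfO G (S.hstO G ω n) e) ∧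
      (S.astOfO G (S.hstO G ω (n + 1))).dep = Function.update (S.astOfO G (S.hstO G ω n)).dep (tgt e) (S.dOfO G ω (S.hstO G ω n) e) := by
  have h1 := S.hst_succ_of_someO hD
  have hc' : (S.astOfO G (S.hstO G ω n)).st.ochoice qNE = some e := by rw [← stN_eqO]; exact hc
  refine ⟨by rw [h1, F_cons_some]; rfl, by rw [h1, ξ_cons_some]; rfl, ?_, ?_, ?_⟩
  · rw [(S.schemeO G).ostN_succ_of_next_some qNE hD, hc]
    rfl
  · rw [h1, astOf_cons_someO, hc']
  · rw [h1, astOf_cons_someO, hc']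
    exact congrArg (Function.update (S.astOfO G (S.hstO G ω n)).dep (tgt e)) (S.depA_readO ω _ e)

/-- A probe along `e` does not change the anchors of macro-vertices other than the target. [folklore] -/
theorem anchors_step_of_neO {ω : BondConfig V} {n : ℕ} {e : Site 2 × MDir} (hc : ((S.schemeO G).ostN qNE n ω).ochoice qNE = some e)
    (hD : (S.schemeO G).E.next (S.hstO G ω n) = some (S.probeO G (S.hstO G ω n) e (S.aOfO G (S.hstO G ω n) e))) {x : Site 2} (hx : x ≠ tgt e) :
    (S.astOfO G (S.hstO G ω (n + 1))).arr x = (S.astOfO G (S.hstO G ω n)).arr x ∧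
      (S.astOfO G (S.hstO G ω (n + 1))).dep x = (S.astOfO G (S.hstO G ω n)).dep x := by
  obtain ⟨-, -, -, harr, hdep⟩ := S.step_someO hc hD
  rw [harr, hdep, Function.update_of_ne hx, Function.update_of_ne hx]
  exact ⟨rfl, rfl⟩

/-- **Anchors of determined macro-vertices are frozen**: a determined vertex is never a target again. [folklore] -/
theorem anchors_eq_of_detO {ω : BondConfig V} {m : ℕ} {x : Site 2} (hx : ((S.schemeO G).ostN qNE m ω).Det x) :
    ∀ {n}, m ≤ n → (S.astOfO G (S.hstO G ω n)).arr x = (S.astOfO G (S.hstO G ω m)).arr x ∧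
      (S.astOfO G (S.hstO G ω n)).dep x = (S.astOfO G (S.hstO G ω m)).dep x := by
  intro n hmn
  induction n with
  | zero =>
    obtain rfl : m = 0 := Nat.le_zero.1 hmn
    exact ⟨rfl, rfl⟩
  | succ n ih =>
    rcases Nat.of_le_succ hmn with hle | rfl
    · obtain ⟨ih1, ih2⟩ := ih hle
      rcases S.next_casesO (G := G) ω n with hD | ⟨e, hc, -, hD⟩
      · obtain ⟨-, -, -, hast⟩ := S.step_noneO hD
        rw [hast]; exact ⟨ih1, ih2⟩
      · have hne : x ≠ tgt e := fun h =>
          (HState.cand_of_ochoice hc).2 (h ▸ (S.schemeO G).det_ostN_mono qNE ω hle hx)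
        obtain ⟨h1, h2⟩ := S.anchors_step_of_neO hc hD hne
        rw [h1, h2]; exact ⟨ih1, ih2⟩
    · exact ⟨rfl, rfl⟩

end KSchA

end KNCells

end Transplant

end Summit.CriticalPhenomena.PercolationContinuityZ3.Theorems

end
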